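import Summits.QuantumFields.GaugeBoot.PlanarCertificateSoundnessZd
import Summits.QuantumFields.GaugeBoot.LoopEquationPairForm
import HarnessLib

/-!
# The torus twin: a planar certificate bounds the `U(N)` / `SU(N)` Wilson state of every finite torus up to the same defect (gauge-boot, large-`N` supplement 10)

HONEST FRAMING (cell `pub-gaugeboot`, page 1 of every file): the venture produces certified bounds
on lattice expectations at stated coupling, gauge group, dimension and torus size; NOT a mass gap,
NOT a continuum limit, NOT a string tension; NOT large `N` unless marked CONDITIONAL; NOT
Yang–Mills-summit-bearing (barriers `FixedCouplingUltralocality`, `PerturbativeInvisibility`).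
This file relates a PLANAR (`N = ∞`, infinite-lattice) certificate to the cell's actual objects —
torus Wilson states at stated `(N, β, L)` — up to an explicit defect; it certifies no number.

## Content

Supplements 2–4 on the TORUS `(ℤ/L)^d` (the cell's certified objects): with the torus Wilson measure
`μ = wilsonMeasure ρ β` and words based at `x`,

* `loopTrT ρ x C U = tr ρ(hol_x C)/N`, `loopWT μ x C = Re E t_C` (`= ⟨W_x(C)⟩_β`),
  `loopQT μ x A B = Re E[t_A t_B]`, `loopImCovT μ x A B = E[Im t_A Im t_B]`, with the dictionary to
  the tree's written-out torus rows (`LoopEquationPairForm`);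
* ★★★ `planarRow_loopDataT_uN` — `U(N)`, every `N`, `β`, `L`: for a closed word SMALL for the torus
  (`Word.Small w L`), the planar row holds EXACTLY on the torus Wilson data (the tree's
  `loopEquation_pairForm_unitaryGroup`); ★★★ `planarRow_loopDataT_suN` — `SU(N)`:
  `= ((#fwd − #bwd)/N²) W(w) − (β/N) Σ Γ(w, P̃)`;
* ★★★ `PlanarCertificate.obj_loopWT_le_uN / _suN` — **a valid planar certificate at `βt = β/N` whose
  row words are small for the torus gives, for the torus Wilson state at `(N, β, L)`:
  `obj(⟨W⟩_{N,β,L}) ≤ bound + Σ_s E(Σ_A m_{sA} Im t_{ℓ_A})²` (`U(N)`), plus the `SU(N)` row defects** —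
  so a planar number can be confronted with the cell's finite-`(N, β, L)` certificates once the
  imaginary-part second moments of the certificate's loops on that torus are bounded.

What is NOT here: any bound on those second moments at fixed `L` (SZZ's variance bound in the tree is
for infinite-volume limit points; on a fixed torus the concentration is the open CONDITION); the
`N → ∞` statement at fixed `L` is then the verbatim analogue of supplement 5. [folklore]; Kazakov–Zheng
arXiv:2203.11360 §3.
-/

noncomputable section

open MeasureTheory
open scoped BigOperators
open Literature.MathematicalPhysics.QuantumFieldTheory
open Literature.MathematicalPhysics.QuantumLattice (fundamentalRep unitaryFundamentalRep continuous_fundamentalRep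
  continuous_unitaryFundamentalRep fundamentalLatticeRep unitaryFundamentalLatticeRep)
open Literature.RepresentationTheory.CompactGroups

namespace Summit.QuantumFields.GaugeBoot

variable {d L N : ℕ}

/-! ## Torus loop data -/

section Data

variable {G : Type*} [Group G] [TopologicalSpace G] [IsTopologicalGroup G] [CompactSpace G]
  [MeasurableSpace G] [BorelSpace G] (ρ : G →* Matrix (Fin N) (Fin N) ℂ)

/-- The normalised complex loop variable on the torus, `t_C(U) = tr ρ(hol_x C)/N`. [folklore] -/
def loopTrT (x : Site d L) (C : Word d) (U : GaugeConfig d L G) : ℂ :=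
  (ρ (wordHolonomy U x C)).trace / (N : ℂ)

omit [TopologicalSpace G] [IsTopologicalGroup G] [CompactSpace G] [MeasurableSpace G] [BorelSpace G] in
/-- Unfolding lemma. [folklore] -/
theorem loopTrT_apply (x : Site d L) (C : Word d) (U : GaugeConfig d L G) :
    loopTrT ρ x C U = (ρ (wordHolonomy U x C)).trace / (N : ℂ) := rfl

omit [TopologicalSpace G] [IsTopologicalGroup G] [CompactSpace G] [MeasurableSpace G] [BorelSpace G] in
/-- `Re t_C = W_x(C)`. [folklore] -/
theorem loopTrT_re (x : Site d L) (C : Word d) (U : GaugeConfig d L G) : (loopTrT ρ x C U).re = wordLoop ρ x C U := by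
  rw [loopTrT, Complex.div_natCast_re, wordLoop_apply, div_eq_inv_mul]

omit [MeasurableSpace G] [BorelSpace G] in
/-- `‖t_C‖ ≤ 1`. [folklore] -/
theorem norm_loopTrT_le_one (hρ : Continuous ρ) (x : Site d L) (C : Word d) (U : GaugeConfig d L G) :
    ‖loopTrT ρ x C U‖ ≤ 1 := by
  rw [loopTrT, norm_div, Complex.norm_natCast]
  rcases Nat.eq_zero_or_pos N with hN | hN
  · subst hN; simp
  · rw [div_le_one (by exact_mod_cast hN)]
    exact norm_trace_rep_le ρ hρ _

omit [CompactSpace G] in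
/-- `t_C` is a.e. strongly measurable for every measure on torus configurations. [folklore] -/
theorem aestronglyMeasurable_loopTrT (hρ : Continuous ρ) (μ : Measure (GaugeConfig d L G)) (x : Site d L) (C : Word d) :
    AEStronglyMeasurable (loopTrT ρ x C) μ := by
  have h := entryMeasurable_wordHolonomy ρ hρ C x
  have htr : Measurable fun U : GaugeConfig d L G => (ρ (wordHolonomy U x C)).trace := by
    simp only [Matrix.trace, Matrix.diag_apply]
    exact Finset.measurable_sum _ fun k _ => h k k
  exact (htr.div_const _).aestronglyMeasurable

/-- `t_C` is integrable for every finite measure. [folklore] -/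
theorem integrable_loopTrT (hρ : Continuous ρ) (μ : Measure (GaugeConfig d L G)) [IsFiniteMeasure μ] (x : Site d L)
    (C : Word d) : Integrable (loopTrT ρ x C) μ :=
  Integrable.of_bound (aestronglyMeasurable_loopTrT ρ hρ μ x C) 1 (Filter.Eventually.of_forall (norm_loopTrT_le_one ρ hρ x C))

/-- `t_A t_B` is integrable for every finite measure. [folklore] -/
theorem integrable_loopTrT_mul (hρ : Continuous ρ) (μ : Measure (GaugeConfig d L G)) [IsFiniteMeasure μ] (x : Site d L)
    (A B : Word d) : Integrable (fun U => loopTrT ρ x A U * loopTrT ρ x B U) μ :=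
  Integrable.of_bound ((aestronglyMeasurable_loopTrT ρ hρ μ x A).mul (aestronglyMeasurable_loopTrT ρ hρ μ x B)) 1
    (Filter.Eventually.of_forall fun U =>
      norm_mul_le_one_of_norm_le_one (norm_loopTrT_le_one ρ hρ x A U) (norm_loopTrT_le_one ρ hρ x B U))

omit [MeasurableSpace G] [BorelSpace G] in
/-- Reversal conjugates: `t_{C⁻¹} = conj t_C` for `C` closed at `x`. [folklore] -/
theorem loopTrT_reverse (hρ : Continuous ρ) (x : Site d L) {C : Word d} (hC : Word.endpoint x C = x) (U : GaugeConfig d L G) :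
    loopTrT ρ x C.reverse U = starRingEnd ℂ (loopTrT ρ x C U) := by
  have h := wordHolonomy_reverse U x C
  rw [hC] at h
  rw [loopTrT, loopTrT, h, CompactGroup.trace_map_inv ρ hρ, map_div₀, Complex.conj_natCast]

/-- `W(C) = Re E t_C` on the torus. [folklore] -/
def loopWT (μ : Measure (GaugeConfig d L G)) (x : Site d L) (C : Word d) : ℝ := (∫ U, loopTrT ρ x C U ∂μ).re

/-- `Q(A, B) = Re E[t_A t_B]` on the torus. [folklore] -/
def loopQT (μ : Measure (GaugeConfig d L G)) (x : Site d L) (A B : Word d) : ℝ :=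
  (∫ U, loopTrT ρ x A U * loopTrT ρ x B U ∂μ).re

/-- `Γ(A, B) = E[Im t_A Im t_B]` on the torus. [folklore] -/
def loopImCovT (μ : Measure (GaugeConfig d L G)) (x : Site d L) (A B : Word d) : ℝ :=
  ∫ U, (loopTrT ρ x A U).im * (loopTrT ρ x B U).im ∂μ

/-- `W(C) = ∫ W_x(C) dμ`. [folklore] -/
theorem loopWT_eq_integral_wordLoop (hρ : Continuous ρ) (μ : Measure (GaugeConfig d L G)) [IsFiniteMeasure μ] (x : Site d L)
    (C : Word d) : loopWT ρ μ x C = ∫ U, wordLoop ρ x C U ∂μ := by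
  have h := integral_re (integrable_loopTrT ρ hρ μ x C)
  simp only [RCLike.re_to_complex] at h
  rw [loopWT, ← h]
  exact integral_congr_ae (Filter.Eventually.of_forall fun U => loopTrT_re ρ x C U)

omit [TopologicalSpace G] [IsTopologicalGroup G] [CompactSpace G] [BorelSpace G] in
/-- `(1/N) Re ∫ tr ρ(hol C) dμ = W(C)`. [folklore] -/
theorem inv_mul_re_integral_trace_eq_loopWT (μ : Measure (GaugeConfig d L G)) (x : Site d L) (C : Word d) :
    (N : ℝ)⁻¹ * (∫ U, (ρ (wordHolonomy U x C)).trace ∂μ).re = loopWT ρ μ x C := by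
  rw [loopWT]; simp only [loopTrT_apply]; rw [integral_div, Complex.div_natCast_re, div_eq_inv_mul]

omit [TopologicalSpace G] [IsTopologicalGroup G] [CompactSpace G] [BorelSpace G] in
/-- `Re ∫ tr ρ(hol A) tr ρ(hol B) dμ / N² = Q(A, B)`. [folklore] -/
theorem re_integral_trace_mul_trace_div_eq_loopQT (μ : Measure (GaugeConfig d L G)) (x : Site d L) (A B : Word d) :
    (∫ U, (ρ (wordHolonomy U x A)).trace * (ρ (wordHolonomy U x B)).trace ∂μ).re / (N : ℝ) ^ 2 = loopQT ρ μ x A B := by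
  rw [loopQT]; simp only [loopTrT_apply]
  have h : ∀ U : GaugeConfig d L G, (ρ (wordHolonomy U x A)).trace / (N : ℂ) * ((ρ (wordHolonomy U x B)).trace / (N : ℂ)) =
      (ρ (wordHolonomy U x A)).trace * (ρ (wordHolonomy U x B)).trace / ((N ^ 2 : ℕ) : ℂ) := fun U => by
    push_cast; ring
  simp_rw [h]
  rw [integral_div, Complex.div_natCast_re]
  push_cast; rfl

/-- `wilsonExpectation (wordLoop) = W(C)` for the torus Wilson measure. [folklore] -/
theorem wilsonExpectation_wordLoop_eq_loopWT [NeZero L] (hρ : Continuous ρ) (β : ℝ) (x : Site d L) (C : Word d) :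
    wilsonExpectation ρ β (wordLoop (G := G) ρ x C) = loopWT ρ (wilsonMeasure (d := d) (L := L) ρ β) x C := by
  haveI := isProbabilityMeasure_wilsonMeasure (d := d) (L := L) (G := G) ρ hρ β
  rw [loopWT_eq_integral_wordLoop ρ hρ]; rfl

/-- ★ `Q(A, B) − Q(A, B⁻¹) = −2 Γ(A, B)` on the torus (`B` closed). [folklore] -/
theorem loopQT_sub_loopQT_reverse (hρ : Continuous ρ) (μ : Measure (GaugeConfig d L G)) [IsFiniteMeasure μ] (x : Site d L)
    (A : Word d) {B : Word d} (hB : Word.endpoint x B = x) :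
    loopQT ρ μ x A B - loopQT ρ μ x A B.reverse = -2 * loopImCovT ρ μ x A B := by
  have hi1 := integrable_loopTrT_mul ρ hρ μ x A B
  have hi2 : Integrable (fun U => loopTrT ρ x A U * starRingEnd ℂ (loopTrT ρ x B U)) μ :=
    Integrable.of_bound ((aestronglyMeasurable_loopTrT ρ hρ μ x A).mul
      (Complex.continuous_conj.comp_aestronglyMeasurable (aestronglyMeasurable_loopTrT ρ hρ μ x B))) 1
      (Filter.Eventually.of_forall fun U => by
        refine norm_mul_le_one_of_norm_le_one (norm_loopTrT_le_one ρ hρ x A U) ?_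
        rw [Complex.norm_conj]; exact norm_loopTrT_le_one ρ hρ x B U)
  have hr1 := integral_re hi1
  have hr2 := integral_re hi2
  simp only [RCLike.re_to_complex] at hr1 hr2
  have hi1' : Integrable (fun U => (loopTrT ρ x A U * loopTrT ρ x B U).re) μ := hi1.re
  have hi2' : Integrable (fun U => (loopTrT ρ x A U * starRingEnd ℂ (loopTrT ρ x B U)).re) μ := hi2.re
  have hQ : loopQT ρ μ x A B.reverse = (∫ U, loopTrT ρ x A U * starRingEnd ℂ (loopTrT ρ x B U) ∂μ).re := by
    rw [loopQT]; congr 2; funext U; rw [loopTrT_reverse ρ hρ x hB]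
  rw [hQ, loopQT, ← hr1, ← hr2, ← integral_sub hi1' hi2', loopImCovT, ← integral_const_mul]
  refine integral_congr_ae (Filter.Eventually.of_forall fun U => ?_)
  simp only [Complex.mul_re, Complex.conj_re, Complex.conj_im]
  ring

variable {ι : Type*} [Fintype ι]

/-- ★★ The relaxation block on torus data: `⟨m mᵀ, [[1,Wᵀ],[W,Q]]⟩ ≥ −E(Σ_A m_A Im t_{ℓ_A})²`. [folklore] -/
theorem shorPairing_loopDataT_ge (hρ : Continuous ρ) (μ : Measure (GaugeConfig d L G)) [IsProbabilityMeasure μ] (x : Site d L)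
    (ℓ : ι → Word d) (m₀ : ℝ) (m : ι → ℝ) :
    -(∫ U, (∑ A, m A * (loopTrT ρ x (ℓ A) U).im) ^ 2 ∂μ) ≤
      shorPairing m₀ m (fun A => loopWT ρ μ x (ℓ A)) (fun A B => loopQT ρ μ x (ℓ A) (ℓ B)) :=
  shorPairing_integral_ge m₀ m (t := fun A => loopTrT ρ x (ℓ A))
    (fun A => aestronglyMeasurable_loopTrT ρ hρ μ x (ℓ A)) (fun A U => norm_loopTrT_le_one ρ hρ x (ℓ A) U)

/-- Gram blocks are sound for the torus Wilson measure (every `β`). [folklore] -/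
theorem gramPairing_loopWT_nonneg [NeZero L] (hρ : Continuous ρ) (β : ℝ) (x : Site d L) {n : ℕ} (O : Fin n → Word d)
    (hO : ∀ i, Word.endpoint x (O i) = x) (c : Fin n → ℝ) :
    0 ≤ gramPairing O c (loopWT ρ (wilsonMeasure (d := d) (L := L) (G := G) ρ β) x) := by
  simp only [gramPairing, ← wilsonExpectation_wordLoop_eq_loopWT ρ hρ β]
  exact sum_mul_wilsonExpectation_wordLoop_nonneg ρ hρ β x O hO c

end Data

/-! ## The planar rows on the torus Wilson measure -/

section Rows

variable [NeZero L]

/-- ★★★ **`U(N)`: the planar rows hold EXACTLY on every torus** `(ℤ/L)^d`, every `N`, every real `β`,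
for a closed word small for the torus. [folklore] -/
theorem planarRow_loopDataT_uN (β : ℝ) (x : Site d L) (a : Fin d) (w : Word d) (hw : Word.endpoint x w = x) (hsm : w.Small L) :
    planarRow (β / N) a w (loopWT (unitaryFundamentalRep (Fin N) ℂ) (wilsonMeasure (d := d) (L := L) (unitaryFundamentalRep (Fin N) ℂ) β) x)
      (loopQT (unitaryFundamentalRep (Fin N) ℂ) (wilsonMeasure (d := d) (L := L) (unitaryFundamentalRep (Fin N) ℂ) β) x) = 0 := by
  have h := loopEquation_pairForm_unitaryGroup (d := d) (L := L) N β x a w hw hsm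
  simp only [re_integral_trace_mul_trace_div_eq_loopQT,
    wilsonExpectation_wordLoop_eq_loopWT _ (continuous_unitaryFundamentalRep (Fin N) ℂ)] at h
  rw [planarRow, ← h]
  congr 1
  ring

/-- ★★★ **`SU(N)`: the planar rows on the torus hold up to `1/N²` and imaginary-part covariances**:
`planarRow (β/N) a w W Q = ((#fwd − #bwd)/N²) W(w) − (β/N) Σ_{ν≠a,ε} Γ(w, P̃_{ν,ε})`. [folklore] -/
theorem planarRow_loopDataT_suN (β : ℝ) (x : Site d L) (a : Fin d) (w : Word d) (hw : Word.endpoint x w = x) (hsm : w.Small L) :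
    planarRow (β / N) a w (loopWT (fundamentalRep (Fin N)) (wilsonMeasure (d := d) (L := L) (fundamentalRep (Fin N)) β) x)
        (loopQT (fundamentalRep (Fin N)) (wilsonMeasure (d := d) (L := L) (fundamentalRep (Fin N)) β) x) =
      ((((Finset.range w.length).filter (w.fwdOccZ a)).card : ℝ) - ((Finset.range w.length).filter (w.bwdOccZ a)).card) /
          (N : ℝ) ^ 2 * loopWT (fundamentalRep (Fin N)) (wilsonMeasure (d := d) (L := L) (fundamentalRep (Fin N)) β) x w -
        β / N * ∑ ν ∈ Finset.univ.erase a, ∑ ε : Bool,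
          loopImCovT (fundamentalRep (Fin N)) (wilsonMeasure (d := d) (L := L) (fundamentalRep (Fin N)) β) x w (plaqWord a ν ε) := by
  haveI := isProbabilityMeasure_wilsonMeasure (d := d) (L := L) (G := Matrix.specialUnitaryGroup (Fin N) ℂ)
    (fundamentalRep (Fin N)) (continuous_fundamentalRep (Fin N)) β
  have h := loopEquation_pairForm_specialUnitaryGroup (d := d) (L := L) N β x a w hw hsm
  simp only [re_integral_trace_mul_trace_div_eq_loopQT,
    wilsonExpectation_wordLoop_eq_loopWT _ (continuous_fundamentalRep (Fin N))] at h
  have hP : ∀ ν ε, loopQT (fundamentalRep (Fin N)) (wilsonMeasure (d := d) (L := L) (fundamentalRep (Fin N)) β) x w (plaqWord a ν ε) -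
      loopQT (fundamentalRep (Fin N)) (wilsonMeasure (d := d) (L := L) (fundamentalRep (Fin N)) β) x w (plaqWord a ν ε).reverse =
        -2 * loopImCovT (fundamentalRep (Fin N)) (wilsonMeasure (d := d) (L := L) (fundamentalRep (Fin N)) β) x w (plaqWord a ν ε) :=
    fun ν ε => loopQT_sub_loopQT_reverse _ (continuous_fundamentalRep (Fin N)) _ x w (endpoint_plaqWord x a ν ε)
  simp only [hP] at h
  simp only [Finset.sum_sub_distrib, Finset.sum_const, nsmul_eq_mul, ← Finset.mul_sum] at h
  rw [planarRow]
  simp only [Finset.sum_sub_distrib]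
  linear_combination h

end Rows

/-! ## The transfer theorem on the torus -/

namespace PlanarCertificate

variable (P : PlanarCertificate d)

section Defects

variable {G : Type*} [Group G] [TopologicalSpace G] [IsTopologicalGroup G] [CompactSpace G]
  [MeasurableSpace G] [BorelSpace G] (ρ : G →* Matrix (Fin N) (Fin N) ℂ)

/-- The relaxation defect on torus data: `γ_s(μ) = E_μ(Σ_A m_{sA} Im t_{ℓ_A})²`. [folklore] -/
def shorDefectT (μ : Measure (GaugeConfig d L G)) (x : Site d L) (s : Fin P.nS) : ℝ :=
  ∫ U, (∑ A, P.shorVec s A * (loopTrT ρ x (P.shorLoop A) U).im) ^ 2 ∂μ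

end Defects

/-- The `SU(N)` row defect on the torus: `length(w_r)/N² + |βt| Σ_{ν,ε} |Γ(w_r, P̃)|`. [folklore] -/
def rowDefectSuNT (μ : Measure (GaugeConfig d L (Matrix.specialUnitaryGroup (Fin N) ℂ))) (x : Site d L) (r : Fin P.nR) : ℝ :=
  ((P.rowWord r).length : ℝ) / (N : ℝ) ^ 2 +
    |P.βt| * ∑ ν ∈ Finset.univ.erase (P.rowAxis r), ∑ ε : Bool,
      |loopImCovT (fundamentalRep (Fin N)) μ x (P.rowWord r) (plaqWord (P.rowAxis r) ν ε)|

variable [NeZero L]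

/-- ★★★ **A PLANAR CERTIFICATE BOUNDS THE `U(N)` TORUS WILSON STATE** at `(N, β, L)` with `β/N = βt`,
all row words closed and small for the torus, Gram words closed, identification rows valid on the data:
`obj(⟨W⟩_{N,β,L}) ≤ bound + Σ_s E(Σ_A m_{sA} Im t_{ℓ_A})²`. [folklore] -/
theorem obj_loopWT_le_uN (hP : P.IsValid) {β : ℝ} (hβ : β / N = P.βt) (x : Site d L)
    (hrow : ∀ r, Word.endpoint x (P.rowWord r) = x) (hsm : ∀ r, (P.rowWord r).Small L)
    (hgram : ∀ j i, Word.endpoint x (P.gramWord j i) = x)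
    (hlin : ∀ e, P.lin e (loopWT (unitaryFundamentalRep (Fin N) ℂ) (wilsonMeasure (d := d) (L := L) (unitaryFundamentalRep (Fin N) ℂ) β) x)
      (loopQT (unitaryFundamentalRep (Fin N) ℂ) (wilsonMeasure (d := d) (L := L) (unitaryFundamentalRep (Fin N) ℂ) β) x) = 0) :
    P.obj (loopWT (unitaryFundamentalRep (Fin N) ℂ) (wilsonMeasure (d := d) (L := L) (unitaryFundamentalRep (Fin N) ℂ) β) x) ≤
      P.bound + ∑ s, P.shorDefectT (unitaryFundamentalRep (Fin N) ℂ)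
        (wilsonMeasure (d := d) (L := L) (unitaryFundamentalRep (Fin N) ℂ) β) x s := by
  haveI := isProbabilityMeasure_wilsonMeasure (d := d) (L := L) (G := Matrix.unitaryGroup (Fin N) ℂ)
    (unitaryFundamentalRep (Fin N) ℂ) (continuous_unitaryFundamentalRep (Fin N) ℂ) β
  have h := P.obj_le_of_defects hP _ _ (fun _ => 0) (P.shorDefectT (unitaryFundamentalRep (Fin N) ℂ)
      (wilsonMeasure (d := d) (L := L) (unitaryFundamentalRep (Fin N) ℂ) β) x)
    (fun r => by rw [← hβ, planarRow_loopDataT_uN β x (P.rowAxis r) (P.rowWord r) (hrow r) (hsm r), abs_zero])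
    (fun j => gramPairing_loopWT_nonneg _ (continuous_unitaryFundamentalRep (Fin N) ℂ) β x _ (hgram j) _)
    (fun s => shorPairing_loopDataT_ge _ (continuous_unitaryFundamentalRep (Fin N) ℂ) _ x P.shorLoop (P.shorConst s) (P.shorVec s))
    hlin
  simpa using h

/-- ★★★ **A PLANAR CERTIFICATE BOUNDS THE `SU(N)` TORUS WILSON STATE** at `(N, β, L)`, `β/N = βt`:
`obj(⟨W⟩_{N,β,L}) ≤ bound + Σ_r |y_r| (length(w_r)/N² + |βt| Σ_{ν,ε} |Γ(w_r, P̃)|) + Σ_s E(Σ_A m_{sA} Im t_{ℓ_A})²`.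
[folklore] -/
theorem obj_loopWT_le_suN (hP : P.IsValid) {β : ℝ} (hβ : β / N = P.βt) (x : Site d L)
    (hrow : ∀ r, Word.endpoint x (P.rowWord r) = x) (hsm : ∀ r, (P.rowWord r).Small L)
    (hgram : ∀ j i, Word.endpoint x (P.gramWord j i) = x)
    (hlin : ∀ e, P.lin e (loopWT (fundamentalRep (Fin N)) (wilsonMeasure (d := d) (L := L) (fundamentalRep (Fin N)) β) x)
      (loopQT (fundamentalRep (Fin N)) (wilsonMeasure (d := d) (L := L) (fundamentalRep (Fin N)) β) x) = 0) :
    P.obj (loopWT (fundamentalRep (Fin N)) (wilsonMeasure (d := d) (L := L) (fundamentalRep (Fin N)) β) x) ≤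
      P.bound + ∑ r, |P.rowMult r| * P.rowDefectSuNT (wilsonMeasure (d := d) (L := L) (fundamentalRep (Fin N)) β) x r +
        ∑ s, P.shorDefectT (fundamentalRep (Fin N)) (wilsonMeasure (d := d) (L := L) (fundamentalRep (Fin N)) β) x s := by
  haveI := isProbabilityMeasure_wilsonMeasure (d := d) (L := L) (G := Matrix.specialUnitaryGroup (Fin N) ℂ)
    (fundamentalRep (Fin N)) (continuous_fundamentalRep (Fin N)) β
  refine P.obj_le_of_defects hP _ _ _ _ (fun r => ?_)
    (fun j => gramPairing_loopWT_nonneg _ (continuous_fundamentalRep (Fin N)) β x _ (hgram j) _)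
    (fun s => shorPairing_loopDataT_ge _ (continuous_fundamentalRep (Fin N)) _ x P.shorLoop (P.shorConst s) (P.shorVec s)) hlin
  -- the row defect
  rw [← hβ, planarRow_loopDataT_suN β x (P.rowAxis r) (P.rowWord r) (hrow r) (hsm r), rowDefectSuNT, hβ]
  set μ := wilsonMeasure (d := d) (L := L) (fundamentalRep (Fin N)) β
  have hW : |loopWT (fundamentalRep (Fin N)) μ x (P.rowWord r)| ≤ 1 := by
    rw [loopWT_eq_integral_wordLoop _ (continuous_fundamentalRep (Fin N))]
    exact abs_wilsonExpectation_wordLoop_le_one _ (continuous_fundamentalRep (Fin N)) β x _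
  have hcf : (((Finset.range (P.rowWord r).length).filter ((P.rowWord r).fwdOccZ (P.rowAxis r))).card : ℝ) ≤
      (P.rowWord r).length := by
    exact_mod_cast (Finset.card_filter_le _ _).trans (Finset.card_range _).le
  have hcb : (((Finset.range (P.rowWord r).length).filter ((P.rowWord r).bwdOccZ (P.rowAxis r))).card : ℝ) ≤
      (P.rowWord r).length := by
    exact_mod_cast (Finset.card_filter_le _ _).trans (Finset.card_range _).le
  have hdiff : |(((Finset.range (P.rowWord r).length).filter ((P.rowWord r).fwdOccZ (P.rowAxis r))).card : ℝ) -
      ((Finset.range (P.rowWord r).length).filter ((P.rowWord r).bwdOccZ (P.rowAxis r))).card| ≤ (P.rowWord r).length := by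
    rw [abs_sub_le_iff]
    constructor <;> linarith [Nat.cast_nonneg (α := ℝ) ((Finset.range (P.rowWord r).length).filter
      ((P.rowWord r).fwdOccZ (P.rowAxis r))).card, Nat.cast_nonneg (α := ℝ) ((Finset.range (P.rowWord r).length).filter
      ((P.rowWord r).bwdOccZ (P.rowAxis r))).card]
  have h1 : |((((Finset.range (P.rowWord r).length).filter ((P.rowWord r).fwdOccZ (P.rowAxis r))).card : ℝ) -
      ((Finset.range (P.rowWord r).length).filter ((P.rowWord r).bwdOccZ (P.rowAxis r))).card) / (N : ℝ) ^ 2 *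
        loopWT (fundamentalRep (Fin N)) μ x (P.rowWord r)| ≤ ((P.rowWord r).length : ℝ) / (N : ℝ) ^ 2 := by
    rw [abs_mul, abs_div, abs_of_nonneg (by positivity : (0 : ℝ) ≤ (N : ℝ) ^ 2)]
    rcases Nat.eq_zero_or_pos N with hN | hN
    · subst hN; simp
    · calc _ ≤ ((P.rowWord r).length : ℝ) / (N : ℝ) ^ 2 * 1 := by gcongr
        _ = _ := mul_one _
  have h2 : |P.βt * ∑ ν ∈ Finset.univ.erase (P.rowAxis r), ∑ ε : Bool, loopImCovT (fundamentalRep (Fin N)) μ x (P.rowWord r)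
      (plaqWord (P.rowAxis r) ν ε)| ≤ |P.βt| * ∑ ν ∈ Finset.univ.erase (P.rowAxis r), ∑ ε : Bool,
        |loopImCovT (fundamentalRep (Fin N)) μ x (P.rowWord r) (plaqWord (P.rowAxis r) ν ε)| := by
    rw [abs_mul]
    gcongr
    exact (Finset.abs_sum_le_sum_abs _ _).trans (Finset.sum_le_sum fun ν _ => Finset.abs_sum_le_sum_abs _ _)
  exact (abs_sub _ _).trans (add_le_add h1 h2)

end PlanarCertificate

end Summit.QuantumFields.GaugeBoot

end
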